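import Mathlib
import Summits.KontsevichZagierPeriods.Zeta5Search.ClusterValuationResidues
import Summits.KontsevichZagierPeriods.Zeta5Search.BigPrimePoles
import HarnessLib

/-!
# ζ(5) search — `MomentVanishing` is a THEOREM: the moments of `R_b` at infinity vanish up to order `2d(b)+4`

Cell `pub-zeta5` (HONEST FRAMING: systematic search; no irrationality claim unless certified), typer seat
generation 7.  Discharges BY NAME the statement `ClusterValuation.MomentVanishing` of gen-2 g8's statement file
(`ClusterValuationResidues.lean`): for `b` in the Brown–Zudilin polytope and `1 ≤ N ≤ 2d(b)+4`,
`μ_N(b) = Σ_{o,q} c_{o,q} C(N−1,o) (−(q+1))^{N−1−o} = 0` — the residue theorem for `R_b` (`deg R_b = −(2d+5)`), one of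
the four hypotheses of gen-2's reduction `casoratianValuationLaw_of` (the refund `[p ≤ d]` of (CV) comes from it).
An identity between rational numbers; nothing about irrationality.

PROOF (no analysis: power series over `ℚ`).  With `k_q = q+1` and `invLin k = Σ_m (−k)^m X^m = (1+kX)^{−1}`
(`[X^m] invLin(k)^{o+1} = C(m+o,o)(−k)^m`, hockey stick), the MOMENT SERIES `M = Σ_{q,o} c_{o,q} X^{o+1} invLin(k_q)^{o+1}`
has `[X^N] M = μ_N` (`coeff_momentSeries`).  The cleared partial-fraction identity `L = numPoly` (`BigPrimePoles.Lpoly_eq_numPoly`)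
evaluated at `y = 1/w + 1` and multiplied by `w^{6n+5}` gives the REFLECTED identity `P₁ = X^{6n+5−D}·G` of polynomials
(`reflPoly_eq`; `D = 1 + 2Σb_j = 6n+1−2d ≥ deg numPoly`, `G` the reversed numerator), and in `ℚ⟦X⟧`:
`Q·M = X·P₁` with `Q = ∏_{s≤n}(1 + k_s X)^6` a unit (`poleSeries_mul_momentSeries`).  Hence `X^{6n+6−D} = X^{2d+5}` divides
`M`, i.e. `μ_N = 0` for `N ≤ 2d+4`.
-/

noncomputable section

open Finset

namespace Summit.KontsevichZagierPeriods.Zeta5Search.BigPrime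

open Polynomial
open Summit.KontsevichZagierPeriods.Zeta5Search.DualSeries (InBox numPoly natDegree_numPoly_le)
open Summit.KontsevichZagierPeriods.Zeta5Search.WedgeDictionary (IsPFData pfData isPFData_pfData exists_isPFData dOf)
open Summit.KontsevichZagierPeriods.Zeta5Search.CasoratianValuation (InPolytope)
open Summit.KontsevichZagierPeriods.Zeta5Search.ClusterValuation (momentAt MomentVanishing)

/-! ### The geometric power series `(1 + kX)^{-1}` and its powers -/

/-- `invLin k = Σ_m (−k)^m X^m = (1 + kX)^{−1}`. -/
def invLin (k : ℚ) : PowerSeries ℚ := PowerSeries.mk fun m => (-k) ^ m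

/-- `(1 + kX) · invLin k = 1`. -/
theorem one_add_mul_invLin (k : ℚ) : (1 + PowerSeries.C k * PowerSeries.X) * invLin k = 1 := by
  ext m
  rw [add_mul, one_mul, map_add, PowerSeries.coeff_one]
  rcases Nat.eq_zero_or_pos m with rfl | hm
  · simp [invLin, PowerSeries.coeff_mk]
  · obtain ⟨m', rfl⟩ : ∃ m', m = m' + 1 := ⟨m - 1, by omega⟩
    rw [mul_assoc, PowerSeries.coeff_C_mul, PowerSeries.coeff_succ_X_mul]
    simp [invLin, PowerSeries.coeff_mk, pow_succ]
    ring

/-- Coefficients of the powers: `[X^m] invLin(k)^{o+1} = C(m+o, o)·(−k)^m`. -/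
theorem coeff_invLin_pow (k : ℚ) (o m : ℕ) :
    PowerSeries.coeff m (invLin k ^ (o + 1)) = ((m + o).choose o : ℚ) * (-k) ^ m := by
  induction o generalizing m with
  | zero => simp [invLin, PowerSeries.coeff_mk]
  | succ o ih =>
    rw [pow_succ, PowerSeries.coeff_mul, Finset.Nat.sum_antidiagonal_eq_sum_range_succ_mk]
    have h : ∀ i ∈ range (m + 1), PowerSeries.coeff i (invLin k ^ (o + 1)) * PowerSeries.coeff (m - i) (invLin k) =
        ((i + o).choose o : ℚ) * (-k) ^ m := by
      intro i hi
      have hi' := mem_range.1 hi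
      rw [ih, invLin, PowerSeries.coeff_mk, mul_assoc, ← pow_add, show i + (m - i) = m by omega]
    rw [Nat.succ_eq_add_one, sum_congr rfl h, ← sum_mul, ← Nat.cast_sum, Nat.sum_range_add_choose,
      show m + o + 1 = m + (o + 1) by omega]

/-- `(1 + kX)^6 · invLin(k)^{o+1} = (1 + kX)^{5−o}` for `o < 6`. -/
theorem pow_six_mul_invLin_pow (k : ℚ) {o : ℕ} (ho : o < 6) :
    (1 + PowerSeries.C k * PowerSeries.X) ^ 6 * invLin k ^ (o + 1) =
      (1 + PowerSeries.C k * PowerSeries.X) ^ (5 - o) := by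
  have h6 : (6 : ℕ) = (5 - o) + (o + 1) := by omega
  rw [h6, pow_add, mul_assoc, ← mul_pow, one_add_mul_invLin, one_pow, mul_one]

/-! ### The moment series -/

/-- The generating series of the moments: `M = Σ_{q,o} c_{o,q} X^{o+1} invLin(q+1)^{o+1}` (`= Σ_N μ_N X^N`). -/
def momentSeries (n : ℕ) (c : ℕ → ℕ → ℚ) : PowerSeries ℚ :=
  ∑ q ∈ range (n + 1), ∑ o ∈ range 6,
    PowerSeries.C (c o q) * PowerSeries.X ^ (o + 1) * invLin ((q : ℚ) + 1) ^ (o + 1)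

/-- The `N`-th coefficient of the moment series is the `N`-th moment `Σ c_{o,q} C(N−1,o) (−(q+1))^{N−1−o}`. -/
theorem coeff_momentSeries (n : ℕ) (c : ℕ → ℕ → ℚ) {N : ℕ} (hN : 1 ≤ N) :
    PowerSeries.coeff N (momentSeries n c) =
      ∑ q ∈ range (n + 1), ∑ o ∈ range 6, c o q * ((N - 1).choose o : ℚ) * (-((q : ℚ) + 1)) ^ (N - 1 - o) := by
  rw [momentSeries, map_sum]
  refine sum_congr rfl fun q _ => ?_
  rw [map_sum]
  refine sum_congr rfl fun o _ => ?_
  rw [mul_assoc, PowerSeries.coeff_C_mul, PowerSeries.coeff_X_pow_mul']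
  split_ifs with h
  · rw [coeff_invLin_pow, show N - (o + 1) + o = N - 1 by omega, show N - (o + 1) = N - 1 - o by omega]
    ring
  · rw [Nat.choose_eq_zero_of_lt (by omega)]
    simp

/-! ### The reflected polynomial identity -/

/-- The reflected cleared expansion `P₁(w) = Σ_{q,o} c_{o,q} w^o (1 + (q+1)w)^{5−o} ∏_{s≠q} (1 + (s+1)w)^6`. -/
def reflPoly (n : ℕ) (c : ℕ → ℕ → ℚ) : ℚ[X] :=
  ∑ q ∈ range (n + 1), ∑ o ∈ range 6,
    C (c o q) * X ^ o * (1 + C ((q : ℚ) + 1) * X) ^ (5 - o) *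
      ∏ s ∈ (range (n + 1)).erase q, (1 + C ((s : ℚ) + 1) * X) ^ 6

/-- `P₁(w) = w^{6n+5} · L(1/w + 1)` for `w ≠ 0` (`L` = `Lpoly` in `y = t + 1` coordinates). -/
theorem reflPoly_eval (n : ℕ) (c : ℕ → ℕ → ℚ) {w : ℚ} (hw : w ≠ 0) :
    (reflPoly n c).eval w = w ^ (6 * n + 5) * (Lpoly n c).eval (1 / w + 1) := by
  rw [reflPoly, Lpoly, eval_finsetSum, eval_finsetSum, mul_sum]
  refine sum_congr rfl fun q hq => ?_
  rw [eval_finsetSum, eval_finsetSum, mul_sum]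
  refine sum_congr rfl fun o ho => ?_
  have ho' := mem_range.1 ho
  simp only [eval_mul, eval_C, eval_pow, eval_add, eval_X, eval_one, eval_prod]
  -- w^{6n+5} = w^o · w^{5-o} · ∏_{s≠q} w^6
  have hcard : #((range (n + 1)).erase q) = n := by rw [card_erase_of_mem hq, card_range]; rfl
  have hw6 : w ^ (6 * n + 5) = w ^ o * w ^ (5 - o) * ∏ _s ∈ (range (n + 1)).erase q, w ^ 6 := by
    rw [prod_const, hcard, ← pow_mul, ← pow_add, ← pow_add]
    congr 1; omega
  have hlin : ∀ k : ℚ, (1 / w + 1 + k) * w = 1 + (k + 1) * w := fun k => by field_simp; ring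
  rw [hw6]
  have hterm : ∀ s : ℕ, w ^ 6 * (1 / w + 1 + (s : ℚ)) ^ 6 = (1 + ((s : ℚ) + 1) * w) ^ 6 := fun s => by
    rw [← mul_pow, mul_comm, hlin]
  have hq' : w ^ (5 - o) * (1 / w + 1 + (q : ℚ)) ^ (5 - o) = (1 + ((q : ℚ) + 1) * w) ^ (5 - o) := by
    rw [← mul_pow, mul_comm, hlin]
  have hP : (∏ _s ∈ (range (n + 1)).erase q, w ^ 6) * ∏ s ∈ (range (n + 1)).erase q, (1 / w + 1 + (s : ℚ)) ^ 6
      = ∏ s ∈ (range (n + 1)).erase q, (1 + ((s : ℚ) + 1) * w) ^ 6 := by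
    rw [← prod_mul_distrib]; exact prod_congr rfl fun s _ => hterm s
  calc c o q * w ^ o * (1 + ((q : ℚ) + 1) * w) ^ (5 - o) * ∏ s ∈ (range (n + 1)).erase q, (1 + ((s : ℚ) + 1) * w) ^ 6
      = c o q * w ^ o * (w ^ (5 - o) * (1 / w + 1 + (q : ℚ)) ^ (5 - o)) *
          ((∏ _s ∈ (range (n + 1)).erase q, w ^ 6) *
            ∏ s ∈ (range (n + 1)).erase q, (1 / w + 1 + (s : ℚ)) ^ 6) := by rw [hq', hP]
    _ = _ := by ring

/-- The reversed numerator: with `Nt = numPoly(X+1) = Σ a_i t^i` of degree `≤ D`, `G = Σ_{i ≤ D} a_i X^{D−i}`. -/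
def revNum (b : ℕ → ℤ) (D : ℕ) : ℚ[X] :=
  ∑ i ∈ range (D + 1), C (((numPoly b).comp (X + C 1)).coeff i) * X ^ (D - i)

/-- `w^{6n+5} · numPoly(1/w + 1) = w^{6n+5−D} · G(w)` when `deg numPoly ≤ D ≤ 6n+5`, `w ≠ 0`. -/
theorem numPoly_eval_refl (b : ℕ → ℤ) {D n : ℕ} (hD : (numPoly b).natDegree ≤ D) (hDn : D ≤ 6 * n + 5)
    {w : ℚ} (hw : w ≠ 0) :
    w ^ (6 * n + 5) * (numPoly b).eval (1 / w + 1) = w ^ (6 * n + 5 - D) * (revNum b D).eval w := by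
  have hcomp : (numPoly b).eval (1 / w + 1) = ((numPoly b).comp (X + C 1)).eval (1 / w) := by
    rw [eval_comp, eval_add, eval_X, eval_C]
  have hdeg : ((numPoly b).comp (X + C 1)).natDegree < D + 1 := by
    rw [natDegree_comp, natDegree_X_add_C, mul_one]; omega
  rw [hcomp, eval_eq_sum_range' hdeg, revNum, eval_finsetSum, mul_sum, mul_sum]
  refine sum_congr rfl fun i hi => ?_
  have hi' := mem_range.1 hi
  rw [eval_mul, eval_C, eval_pow, eval_X]
  have e : 6 * n + 5 = (6 * n + 5 - D) + (D - i) + i := by omega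
  have : w ^ (6 * n + 5) * (1 / w) ^ i = w ^ (6 * n + 5 - D) * w ^ (D - i) := by
    conv_lhs => rw [e]
    rw [pow_add, pow_add, one_div_pow, mul_assoc, mul_one_div, div_self (pow_ne_zero i hw), mul_one]
  calc w ^ (6 * n + 5) * (((numPoly b).comp (X + C 1)).coeff i * (1 / w) ^ i)
      = ((numPoly b).comp (X + C 1)).coeff i * (w ^ (6 * n + 5) * (1 / w) ^ i) := by ring
    _ = _ := by rw [this]; ring

/-- **The reflected identity**: `P₁ = X^{6n+5−D} · G` for data of `R_b` (`deg numPoly ≤ D ≤ 6n+5`). -/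
theorem reflPoly_eq (b : ℕ → ℤ) {c : ℕ → ℕ → ℚ} (hc : IsPFData b c) {D : ℕ} (hD : (numPoly b).natDegree ≤ D)
    (hDn : D ≤ 6 * (b 0).toNat + 5) :
    reflPoly (b 0).toNat c = X ^ (6 * (b 0).toNat + 5 - D) * revNum b D := by
  set n := (b 0).toNat with hn
  apply Polynomial.eq_of_infinite_eval_eq
  have hsub : (fun m : ℕ => ((m : ℚ) + 1)) '' Set.univ ⊆
      {x : ℚ | (reflPoly n c).eval x = (X ^ (6 * n + 5 - D) * revNum b D).eval x} := by
    rintro x ⟨m, -, rfl⟩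
    have hw : (m : ℚ) + 1 ≠ 0 := by positivity
    show (reflPoly n c).eval ((m : ℚ) + 1) = (X ^ (6 * n + 5 - D) * revNum b D).eval ((m : ℚ) + 1)
    rw [reflPoly_eval n c hw, Lpoly_eq_numPoly b hc, eval_mul, eval_pow, eval_X, numPoly_eval_refl b hD hDn hw]
  refine Set.Infinite.mono hsub (Set.infinite_univ.image fun x _ y _ hxy => ?_)
  exact_mod_cast (add_left_inj (1 : ℚ)).1 hxy

/-! ### From the polynomial identity to the power series identity -/

/-- The pole product as a power series: `Q = ∏_{s ≤ n} (1 + (s+1)X)^6`. -/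
def poleSeries (n : ℕ) : PowerSeries ℚ :=
  ∏ s ∈ range (n + 1), (1 + PowerSeries.C ((s : ℚ) + 1) * PowerSeries.X) ^ 6

/-- The reflected expansion as a power series. -/
def reflSeries (n : ℕ) (c : ℕ → ℕ → ℚ) : PowerSeries ℚ :=
  ∑ q ∈ range (n + 1), ∑ o ∈ range 6,
    PowerSeries.C (c o q) * PowerSeries.X ^ o * (1 + PowerSeries.C ((q : ℚ) + 1) * PowerSeries.X) ^ (5 - o) *
      ∏ s ∈ (range (n + 1)).erase q, (1 + PowerSeries.C ((s : ℚ) + 1) * PowerSeries.X) ^ 6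

/-- The power series of `P₁` is `reflSeries`. -/
theorem coe_reflPoly (n : ℕ) (c : ℕ → ℕ → ℚ) : ((reflPoly n c : ℚ[X]) : PowerSeries ℚ) = reflSeries n c := by
  rw [← Polynomial.coeToPowerSeries.ringHom_apply, reflPoly, reflSeries, map_sum]
  refine sum_congr rfl fun q _ => ?_
  rw [map_sum]
  refine sum_congr rfl fun o _ => ?_
  simp only [map_mul, map_pow, map_prod, map_add, map_one, Polynomial.coeToPowerSeries.ringHom_apply,
    Polynomial.coe_C, Polynomial.coe_X]

/-- `Q · M = X · P₁` in `ℚ⟦X⟧`. -/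
theorem poleSeries_mul_momentSeries (n : ℕ) (c : ℕ → ℕ → ℚ) :
    poleSeries n * momentSeries n c = PowerSeries.X * reflSeries n c := by
  rw [momentSeries, mul_sum, reflSeries, mul_sum]
  refine sum_congr rfl fun q hq => ?_
  rw [mul_sum, mul_sum]
  refine sum_congr rfl fun o ho => ?_
  have ho' := mem_range.1 ho
  rw [poleSeries, ← mul_prod_erase _ _ hq]
  have key : (1 + PowerSeries.C ((q : ℚ) + 1) * PowerSeries.X) ^ 6 *
      (PowerSeries.C (c o q) * PowerSeries.X ^ (o + 1) * invLin ((q : ℚ) + 1) ^ (o + 1)) =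
      PowerSeries.C (c o q) * PowerSeries.X ^ (o + 1) * (1 + PowerSeries.C ((q : ℚ) + 1) * PowerSeries.X) ^ (5 - o) := by
    rw [← pow_six_mul_invLin_pow ((q : ℚ) + 1) ho']; ring
  calc (1 + PowerSeries.C ((q : ℚ) + 1) * PowerSeries.X) ^ 6 *
        (∏ s ∈ (range (n + 1)).erase q, (1 + PowerSeries.C ((s : ℚ) + 1) * PowerSeries.X) ^ 6) *
        (PowerSeries.C (c o q) * PowerSeries.X ^ (o + 1) * invLin ((q : ℚ) + 1) ^ (o + 1))
      = (∏ s ∈ (range (n + 1)).erase q, (1 + PowerSeries.C ((s : ℚ) + 1) * PowerSeries.X) ^ 6) *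
        ((1 + PowerSeries.C ((q : ℚ) + 1) * PowerSeries.X) ^ 6 *
          (PowerSeries.C (c o q) * PowerSeries.X ^ (o + 1) * invLin ((q : ℚ) + 1) ^ (o + 1))) := by ring
    _ = (∏ s ∈ (range (n + 1)).erase q, (1 + PowerSeries.C ((s : ℚ) + 1) * PowerSeries.X) ^ 6) *
        (PowerSeries.C (c o q) * PowerSeries.X ^ (o + 1) *
          (1 + PowerSeries.C ((q : ℚ) + 1) * PowerSeries.X) ^ (5 - o)) := by rw [key]
    _ = _ := by rw [pow_succ]; ring

/-- `Q` is a unit of `ℚ⟦X⟧` (constant coefficient `1`). -/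
theorem isUnit_poleSeries (n : ℕ) : IsUnit (poleSeries n) := by
  rw [PowerSeries.isUnit_iff_constantCoeff, poleSeries, map_prod]
  simp

/-- **Low moments vanish**: `[X^N] M = 0` for `N < 6n + 6 − D` (`deg numPoly ≤ D ≤ 6n+5`). -/
theorem coeff_momentSeries_eq_zero (b : ℕ → ℤ) {c : ℕ → ℕ → ℚ} (hc : IsPFData b c) {D : ℕ}
    (hD : (numPoly b).natDegree ≤ D) (hDn : D ≤ 6 * (b 0).toNat + 5) {N : ℕ} (hN : N < 6 * (b 0).toNat + 6 - D) :
    PowerSeries.coeff N (momentSeries (b 0).toNat c) = 0 := by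
  set n := (b 0).toNat with hn
  obtain ⟨u, hu⟩ := isUnit_poleSeries n
  have hQM := poleSeries_mul_momentSeries n c
  rw [← coe_reflPoly, reflPoly_eq b hc hD hDn, Polynomial.coe_mul, Polynomial.coe_pow, Polynomial.coe_X,
    ← mul_assoc, ← pow_succ'] at hQM
  have hM : momentSeries n c =
      ((u⁻¹ : (PowerSeries ℚ)ˣ) : PowerSeries ℚ) * (PowerSeries.X ^ (6 * n + 5 - D + 1) * (revNum b D : PowerSeries ℚ)) := by
    rw [← hQM, ← hu, ← mul_assoc, Units.inv_mul, one_mul]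
  have hdvd : (PowerSeries.X : PowerSeries ℚ) ^ (6 * n + 5 - D + 1) ∣ momentSeries n c := by
    rw [hM]; exact (dvd_mul_right _ _).mul_left _
  exact (PowerSeries.X_pow_dvd_iff.1 hdvd) N (by omega)

/-- **`MomentVanishing` is a THEOREM**: for `b` in the polytope, `μ_N(b) = 0` for `1 ≤ N ≤ 2d(b)+4` (the series
`R_b` has a zero of order `2d+5` at infinity). -/
theorem momentVanishing_holds : MomentVanishing := by
  intro b N hb hN1 hN2
  obtain ⟨hbox, h2, h3⟩ := hb
  obtain ⟨c, hc⟩ := exists_isPFData b hbox (by omega)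
  have hpf := isPFData_pfData hc
  set n := (b 0).toNat with hn
  -- degree bookkeeping: deg numPoly ≤ 1 + 2Σβ = 6n + 1 − 2d
  obtain ⟨e0, hS, hβ, hS3⟩ := polytope_data b hbox h2 h3
  set D := 1 + 2 * ∑ j ∈ range 7, (b (j + 1)).toNat with hDdef
  have hD : (numPoly b).natDegree ≤ D := natDegree_numPoly_le b
  have hd : dOf b = 3 * (n : ℤ) - ((∑ j ∈ range 7, (b (j + 1)).toNat : ℕ) : ℤ) := by rw [dOf, hS, e0]
  have hDn : D ≤ 6 * n + 5 := by omega
  have hN : N < 6 * n + 6 - D := by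
    have : (N : ℤ) ≤ 2 * dOf b + 4 := hN2
    rw [hd] at this
    omega
  have h0 := coeff_momentSeries_eq_zero b hpf hD hDn hN
  rw [coeff_momentSeries _ _ hN1, sum_comm] at h0
  rw [momentAt, ← h0]

end Summit.KontsevichZagierPeriods.Zeta5Search.BigPrime

end
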